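import Summits.BirchSwinnertonDyer.BirchSwinnertonDyer.Theorems.QuadraticBranchSignedControlPlusEtaNonsurjThetaFunctionalEquationNormCoordinateZeros
import HarnessLib

/-!
# Route `QuadraticBranchSignedControl` (rung K8, cell `bsd-potss`), residual crux `PlusEtaMainConjectureNonsurj`
# (stmt-BirchSwinnertonDyer-19606): THE FUNCTIONAL EQUATION ON THE QUADRATIC BRANCH, XXIX — RATIONAL ZERO PAIRS ARE SQUARE ROOTS OF
# NORM ROOTS: for `s₀ ∈ pℤ_p` the point `t = S⁻¹(s₀)` of the disc has `S(t) = s₀`, norm `t + t^ι = s₀²`, and **`H(s₀²) = 0 ⟹ L(t) = L(t^ι) = 0`**;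
# with Part XXVIII: the `ℤ_p`-RATIONAL zeros of `L` in the punctured disc are EXACTLY the pairs `{S⁻¹(s₀), S⁻¹(−s₀)}` over the roots
# `z₀ = s₀²` of `H` that are squares (seat `bsd-potss-k8eta-c2` g30; kernel, class-wide, fact-free)

WHY. Part XXVIII proved `L(t) = 0 ⟺ (t = 0 ∧ ord_T L > 0) ∨ H(t + t^ι) = 0` and that every norm `t + t^ι = S(t)²` is a square. THIS FILE
proves the converse direction of the dictionary: evaluation at disc points commutes with substitution (the tree's
`padicInt_eval₂_powerSeries_subst`, as in Part XV's `evalHom_invol`), so for `s₀ ∈ pℤ_p` the point `t := ev_{s₀}(S⁻¹)` (`S⁻¹` the compositional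
inverse of `S = T(1+T)^{−1/2}`, Mathlib `substInvOfIsUnit`) lies in the disc and satisfies **`S(t) = s₀`**, hence `t + t^ι = s₀²` and, for
any datum `L = a·P·U` with `P = T^{r₀}(1+T)^k H(Z)` (Part XXVI), **`H(s₀²) = 0 ⟹ L(t) = 0` and `L(t^ι) = 0`**, `t ≠ 0` if `s₀ ≠ 0`. So the
`ℤ_p`-rational zeros of `L_p^±(V, η, X)` in the punctured open disc are in bijection with `{±s₀ : s₀ ≠ 0, H(s₀²) = 0}`, i.e. with the square
roots of those roots of `H` in `pℤ_p` that are squares; roots `z₀` of `H` with `v_p(z₀)` odd (P-30Z: 12 of 19 `k = 1` level-4 rows) carry no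
rational zero.

MATHEMATICS. (§85) `ev_t(G(a)) = ev_{ev_t(a)}(G)` for `a(0) = 0`, `‖t‖ < 1` (then `‖ev_t(a)‖ < 1`: `a = T·a'`). (§86) `t = ev_{s₀}(S⁻¹)`:
`ev_t(S) = ev_{s₀}(S(S⁻¹)) = ev_{s₀}(T) = s₀`; `ev_t(Z) = ev_t(S)² = s₀²`; `ev_t(Z) = t + t^ι` (Part XXVIII); `t = 0 ⟹ s₀ = S(0) = 0`.
(§87) Part XXVIII's criterion at `t`; the partner by Part XV (`evalHom_eq_zero_iff_of_invol_eq`: `L(t) = 0 ⟺ L(t^ι) = 0`).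

WHAT. §85 `norm_evalHom_lt_one_of_constantCoeff_eq_zero`, **`evalHom_subst`**; §86 `norm_evalHom_substInv_lt_one`, **`evalHom_sqrtZ_evalHom_substInv`**
(`S(S⁻¹(s₀)) = s₀`), `evalHom_trace_evalHom_substInv` (`Z(t) = s₀²`), `add_partner_eq_sq` (`t + t^ι = s₀²`), `evalHom_substInv_ne_zero`; §87
**`evalHom_eq_zero_of_sq_root`** (`H(s₀²) = 0 ⟹ L(S⁻¹(s₀)) = 0`), **`exists_zero_pair_of_sq_root_of_invol_eq`** (for every nonzero FE solution / datum:
a root `s₀²` of `H`, `s₀ ∈ pℤ_p ∖ 0`, yields the rational zero pair `{t, t^ι}`, `t ≠ 0`, `t + t^ι = s₀²`).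

HONEST FRAMING (cell `bsd-potss`; FULL-BSD rank ≤ 1 programme, HUMAN RULING D-0036/D-0074): TOOL THEOREMS ONLY — no definition, no named
fact, no `sorry`, axioms standard; nothing about (A), (C1⁺_η), C-cc-1 or `BSD(W,p)` of any pair is claimed; no stub of 19606 is proved;
crux and route OPEN; nothing booked. `--supports stmt-BirchSwinnertonDyer-19606`.

References: [Washington1997] §7.1, §13.2; [MazurTateTeitelbaum1986Invent] §I.17; [GreenbergLNM1716] §1 (pp. 67–68), §5; Bourbaki, Algèbre IV §4
(substitution and evaluation of formal series). Tree: `PadicSeriesEvaluation.lean` (`evalHom`, `padicInt_eval₂_powerSeries_subst`), Parts XV,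
XXIII (`subst_substInv…`), XXVI, XXVIII; Mathlib `PowerSeries.substInvOfIsUnit`.
-/

set_option autoImplicit false
set_option linter.dupNamespace false
noncomputable section

open scoped Classical MatrixGroups ModularForm Topology

open PowerSeries CongruenceSubgroup WeierstrassCurve Literature.NumberTheory.EllipticCurves Literature.NumberTheory.EllipticCurves.ModularForms
open Literature.NumberTheory.EllipticCurves.IwasawaAlgebra
open Summit.BirchSwinnertonDyer.Rank1Residual.Additive

namespace Summit.BirchSwinnertonDyer.BirchSwinnertonDyer.Theorems.EtaThetaFunctionalEquation

variable {p : ℕ} [hp : Fact p.Prime] {r : ℤ_[p]} {S Z : IwasawaAlgebra p}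

/-! ## §85 Evaluation commutes with substitution -/

/-- A series without constant term takes values in the open disc: `a(0) = 0`, `‖t‖ < 1 ⟹ ‖a(t)‖ < 1` (`a = T·a'`, `‖a'(t)‖ ≤ 1`). [folklore] -/
theorem norm_evalHom_lt_one_of_constantCoeff_eq_zero {a : IwasawaAlgebra p} (ha0 : constantCoeff a = 0) {t : ℤ_[p]} (ht : ‖t‖ < 1) :
    ‖evalHom t ht a‖ < 1 := by
  have ha : a = X * PowerSeries.mk fun n ↦ coeff (n + 1) a := by
    conv_lhs => rw [eq_X_mul_shift_add_const a, ha0, map_zero, add_zero]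
  rw [ha, map_mul, evalHom_X_eq ht, norm_mul]
  exact mul_lt_one_of_nonneg_of_lt_one_left (norm_nonneg _) ht (PadicInt.norm_le_one _)

/-- **`ev_t(G(a)) = ev_{a(t)}(G)`**: evaluation at a disc point commutes with substitution of a series without constant term (the tree's
`padicInt_eval₂_powerSeries_subst`). [cite: Washington1997, §7.1] -/
theorem evalHom_subst {a : IwasawaAlgebra p} (ha0 : constantCoeff a = 0) {t : ℤ_[p]} (ht : ‖t‖ < 1)
    (hat : ‖evalHom t ht a‖ < 1) (G : IwasawaAlgebra p) :
    evalHom t ht (PowerSeries.subst a G) = evalHom (evalHom t ht a) hat G := by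
  have h := padicInt_eval₂_powerSeries_subst (HasSubst.of_constantCoeff_zero' ha0) (PowerSeries.hasEval (padicInt_hasEval ht)) G
  have h2 : MvPowerSeries.eval₂ (RingHom.id ℤ_[p]) (fun _ : Unit => t) a = evalHom t ht a := by
    rw [evalHom_apply]; rfl
  rw [h2] at h
  rw [evalHom_apply, evalHom_apply]
  exact h

/-! ## §86 The point `t = S⁻¹(s₀)`: `S(t) = s₀`, `t + t^ι = s₀²` -/

/-- `‖S⁻¹(s₀)‖ < 1` for `‖s₀‖ < 1` (`S⁻¹(0) = 0`). [folklore] -/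
theorem norm_evalHom_substInv_lt_one (hS : S = X * binomialSeries ℤ_[p] r) {s₀ : ℤ_[p]} (hs₀ : ‖s₀‖ < 1) :
    ‖evalHom s₀ hs₀ (substInvOfIsUnit S (isUnit_coeff_one_sqrtZ hS))‖ < 1 :=
  norm_evalHom_lt_one_of_constantCoeff_eq_zero (constantCoeff_substInvOfIsUnit _ _) hs₀

/-- **`S(S⁻¹(s₀)) = s₀`**: at `t = ev_{s₀}(S⁻¹)` the series `S = T(1+T)^r` takes the value `s₀`. [cite: Washington1997, §7.1] -/
theorem evalHom_sqrtZ_evalHom_substInv (hS : S = X * binomialSeries ℤ_[p] r) {s₀ : ℤ_[p]} (hs₀ : ‖s₀‖ < 1) :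
    evalHom (evalHom s₀ hs₀ (substInvOfIsUnit S (isUnit_coeff_one_sqrtZ hS))) (norm_evalHom_substInv_lt_one hS hs₀) S = s₀ := by
  rw [← evalHom_subst (constantCoeff_substInvOfIsUnit _ _) hs₀, subst_substInvOfIsUnit_right _ (constantCoeff_sqrtZ hS), evalHom_X_eq hs₀]

/-- `Z(S⁻¹(s₀)) = s₀²` (`Z = S²`, `2r = −1`). [cite: Washington1997, §13.2] -/
theorem evalHom_trace_evalHom_substInv (hr : 2 * r = -1) (hS : S = X * binomialSeries ℤ_[p] r) (hZ : Z = X + invol p X)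
    {s₀ : ℤ_[p]} (hs₀ : ‖s₀‖ < 1) :
    evalHom (evalHom s₀ hs₀ (substInvOfIsUnit S (isUnit_coeff_one_sqrtZ hS))) (norm_evalHom_substInv_lt_one hS hs₀) Z = s₀ ^ 2 := by
  have hSZ : S ^ 2 = Z := by rw [hS, sqrtZ_sq_eq_X_add_invol_X hr, hZ]
  conv_rhs => rw [← evalHom_sqrtZ_evalHom_substInv hS hs₀]
  rw [← map_pow, hSZ]

/-- **`t + t^ι = s₀²` for `t = S⁻¹(s₀)`** and its partner `t^ι`. [cite: MazurTateTeitelbaum1986Invent, §I.17] -/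
theorem add_partner_eq_sq (hr : 2 * r = -1) (hS : S = X * binomialSeries ℤ_[p] r) {s₀ : ℤ_[p]} (hs₀ : ‖s₀‖ < 1) {t' : ℤ_[p]}
    (htt : (1 + evalHom s₀ hs₀ (substInvOfIsUnit S (isUnit_coeff_one_sqrtZ hS))) * (1 + t') = 1) :
    evalHom s₀ hs₀ (substInvOfIsUnit S (isUnit_coeff_one_sqrtZ hS)) + t' = s₀ ^ 2 := by
  rw [← evalHom_trace rfl (norm_evalHom_substInv_lt_one hS hs₀) htt, evalHom_trace_evalHom_substInv hr hS rfl hs₀]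

/-- `S⁻¹(s₀) = 0 ⟹ s₀ = 0` (`S(0) = 0`). [folklore] -/
theorem eq_zero_of_evalHom_substInv_eq_zero (hS : S = X * binomialSeries ℤ_[p] r) {s₀ : ℤ_[p]} (hs₀ : ‖s₀‖ < 1)
    (h0 : evalHom s₀ hs₀ (substInvOfIsUnit S (isUnit_coeff_one_sqrtZ hS)) = 0) : s₀ = 0 := by
  have h := evalHom_sqrtZ_evalHom_substInv hS hs₀
  have h2 := congr_arg (evalHom _ (norm_evalHom_substInv_lt_one hS hs₀)) hS
  rw [map_mul, evalHom_X_eq (norm_evalHom_substInv_lt_one hS hs₀), h] at h2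
  exact h2.trans (mul_eq_zero_of_left h0 _)

/-! ## §87 Square roots of norm roots give rational zero pairs -/

/-- **`H(s₀²) = 0 ⟹ L(S⁻¹(s₀)) = 0`** for a datum `L = a·P·U`, `P = T^{r₀}·normPoly H` (`a ≠ 0`, `U ∈ Λˣ`; `2r = −1`, `S = T(1+T)^r`), `s₀ ∈ ℤ_p`,
`‖s₀‖ < 1`. [cite: Washington1997, §7.1] [cite: MazurTateTeitelbaum1986Invent, §I.17] -/
theorem evalHom_eq_zero_of_sq_root (hr : 2 * r = -1) (hS : S = X * binomialSeries ℤ_[p] r) {H : Polynomial ℤ_[p]} {r₀ : ℕ}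
    {P : Polynomial ℤ_[p]}
    (hP : P = Polynomial.X ^ r₀ * ∑ i ∈ Finset.range (H.natDegree + 1),
        Polynomial.C (H.coeff i) * Polynomial.X ^ (2 * i) * (1 + Polynomial.X) ^ (H.natDegree - i))
    {a : ℤ_[p]} (ha : a ≠ 0) {U : IwasawaAlgebra p} (hU : IsUnit U) {L : IwasawaAlgebra p} (hL : L = C a * (P : IwasawaAlgebra p) * U)
    {s₀ : ℤ_[p]} (hs₀ : ‖s₀‖ < 1) (hH : H.eval (s₀ ^ 2) = 0) :
    evalHom (evalHom s₀ hs₀ (substInvOfIsUnit S (isUnit_coeff_one_sqrtZ hS))) (norm_evalHom_substInv_lt_one hS hs₀) L = 0 := by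
  obtain ⟨t', htt⟩ := exists_partner_of_norm_lt_one (norm_evalHom_substInv_lt_one hS hs₀)
  rw [evalHom_eq_zero_iff_of_eq_X_pow_mul_normPoly hP ha hU hL _ htt, add_partner_eq_sq hr hS hs₀ htt]
  exact Or.inr hH

/-- **RATIONAL ZERO PAIRS FROM SQUARE ROOTS OF NORM ROOTS.** `p` odd (`2r = −1`, `S`, `Z`), `M ≠ 0` with `ι M = w(1+T)^e M`, ANY datum
`M = p^m·P·U`; let `H ∈ ℤ_p[Z]` be the distinguished norm-coordinate polynomial of Part XXVI (`P = T^{r₀}(1+T)^k H(Z)`, produced here). Then for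
every `s₀ ∈ ℤ_p` with `‖s₀‖ < 1`, `s₀ ≠ 0` and **`H(s₀²) = 0`** there is a pair of DISTINCT-from-`0` disc points `t, t'` with `(1+t)(1+t') = 1`,
`t + t' = s₀²`, **`M(t) = 0` and `M(t') = 0`**. With Part XXVIII (`M(t) = 0 ⟹ H(t + t^ι) = 0`, `t + t^ι ∈ (ℤ_p)²`) this is the complete dictionary
between `ℤ_p`-rational zeros of `M` in the punctured disc and square roots of the roots of `H`. [cite: Washington1997, §7.1, §13.2]
[cite: MazurTateTeitelbaum1986Invent, §I.17] [cite: GreenbergLNM1716, §1 (pp. 67–68)] -/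
theorem exists_zero_pair_of_sq_root_of_invol_eq (hr : 2 * r = -1) (hS : S = X * binomialSeries ℤ_[p] r) (hZ : Z = X + invol p X)
    {M : IwasawaAlgebra p} (hM0 : M ≠ 0) {w e : ℤ_[p]} (hFE : invol p M = C w * binomialSeries ℤ_[p] e * M)
    {m : ℕ} {P : Polynomial ℤ_[p]} (hP : P.IsDistinguishedAt (IsLocalRing.maximalIdeal ℤ_[p])) {U : IwasawaAlgebra p} (hU : IsUnit U)
    (hMP : M = C ((p : ℤ_[p]) ^ m) * (P : IwasawaAlgebra p) * U) :
    ∃ H : Polynomial ℤ_[p], H.IsDistinguishedAt (IsLocalRing.maximalIdeal ℤ_[p]) ∧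
      (P : IwasawaAlgebra p) = X ^ (PowerSeries.order M).toNat * (1 + X) ^ H.natDegree * PowerSeries.subst Z (H : IwasawaAlgebra p) ∧
      ∀ {s₀ : ℤ_[p]}, ‖s₀‖ < 1 → s₀ ≠ 0 → H.eval (s₀ ^ 2) = 0 →
        ∃ (t t' : ℤ_[p]) (ht : ‖t‖ < 1) (ht' : ‖t'‖ < 1), t ≠ 0 ∧ (1 + t) * (1 + t') = 1 ∧ t + t' = s₀ ^ 2 ∧
          evalHom t ht M = 0 ∧ evalHom t' ht' M = 0 := by
  obtain ⟨-, H, -, -, hH, -, -, hPeq, hPZ, -⟩ := weierstrass_eq_X_pow_mul_normPoly_of_invol_eq hr hS hZ hM0 hFE hP hU hMP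
  have hpm : ((p : ℤ_[p]) ^ m) ≠ 0 := pow_ne_zero _ (Nat.cast_ne_zero.mpr hp.out.ne_zero)
  refine ⟨H, hH, hPZ, fun {s₀} hs₀ hs0 hHs ↦ ?_⟩
  set t := evalHom s₀ hs₀ (substInvOfIsUnit S (isUnit_coeff_one_sqrtZ hS)) with ht_def
  have ht : ‖t‖ < 1 := norm_evalHom_substInv_lt_one hS hs₀
  obtain ⟨t', htt⟩ := exists_partner_of_norm_lt_one ht
  have ht' : ‖t'‖ < 1 := norm_lt_one_of_partner htt ht
  have hzero : evalHom t ht M = 0 := evalHom_eq_zero_of_sq_root hr hS hPeq hpm hU hMP hs₀ hHs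
  have hzero' : evalHom t' ht' M = 0 := by
    rw [← evalHom_invol ht ht' htt M, hFE, map_mul, map_mul, hzero, mul_zero]
  exact ⟨t, t', ht, ht', fun h0 ↦ hs0 (eq_zero_of_evalHom_substInv_eq_zero hS hs₀ h0), htt, add_partner_eq_sq hr hS hs₀ htt,
    hzero, hzero'⟩

end Summit.BirchSwinnertonDyer.BirchSwinnertonDyer.Theorems.EtaThetaFunctionalEquation

end
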